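import Mathlib
import HarnessLib
import Literature.NumberTheory.Transcendental.KZCalculus
import Literature.NumberTheory.Transcendental.KZLogCalculusProofs
import Literature.NumberTheory.Transcendental.SemialgebraicMapsProofs

/-!
# Stub `stub_rebaseOne` (crux `ArrangementNormalForm`, line `janus-bands`) — part `Cov`

Rule (2) of the Kontsevich–Zagier calculus in the plane `ℝ² = (Fin 2 → ℝ)`, as used by
`stub_rebaseOne` (skeleton v4 of crux `ArrangementNormalForm`, line `janus-bands`): the PULL-BACK
form of the change-of-variables move (`cov_pull`: a new representation on `R` parametrising the
old domain by a semialgebraic injective differentiable map `Ψ`, absolute convergence transported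
by `MeasureTheory.integrableOn_image_iff_integrableOn_abs_det_fderiv_smul`), the fibred AFFINE maps
`(y, t) ↦ (α y + β, l t + μ y + ν)` (shears, base rescalings, reflections; Jacobian `α l`) and the
BLOW-UP maps `(y, s) ↦ (y, γ y + δ + s (y − p))` of a pencil of lines through a point of the letter
line (Jacobian `y − p`), with their derivatives, determinants, injectivity and semialgebraicity.

References: M. Kontsevich, D. Zagier, *Periods* (2001), §1.2, rule (2).
-/

noncomputable section

open Set MeasureTheory
open Literature.NumberTheory.Transcendental
open Literature.ModelTheory.ExponentialFields

namespace Summit.KontsevichZagierPeriods.ArrangementNormalForm.JanusBands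

namespace RebaseOne

/-! ### The pull-back form of rule (2) -/

/-- **Rule (2), pull-back form.** If `Ψ` is `ℚ`-semialgebraic, injective and differentiable on a
`ℚ`-semialgebraic `R ⊆ ℝ²` with `Ψ '' R = r.domain`, and `f'` is a `ℚ`-semialgebraic function on
`R` with `f' = (r.integrand ∘ Ψ) · |det Ψ'|`, then `f'` is absolutely integrable on `R` and the
representation `r' = [R, f']` satisfies `[r] − [r'] ∈ KZ.relations`. -/
theorem cov_pull (r : KZ.IntegralRep 2) {R : Set (Fin 2 → ℝ)} (hR : IsSemialgebraic ℚ R)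
    (Ψ : (Fin 2 → ℝ) → (Fin 2 → ℝ)) (Ψ' : (Fin 2 → ℝ) → (Fin 2 → ℝ) →L[ℝ] (Fin 2 → ℝ))
    (hsa : IsSemialgebraicMapOn ℚ R Ψ) (hder : ∀ x ∈ R, HasFDerivWithinAt Ψ (Ψ' x) R x)
    (hinj : InjOn Ψ R) (himg : Ψ '' R = r.domain) (f' : (Fin 2 → ℝ) → ℝ)
    (hf'sa : IsSemialgebraicFunOn ℚ R f')
    (hf : ∀ x ∈ R, f' x = r.integrand (Ψ x) * |(Ψ' x).det|) :
    ∃ r' : KZ.IntegralRep 2, r'.domain = R ∧ r'.integrand = f' ∧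
      KZ.of r - KZ.of r' ∈ KZ.relations := by
  have hRm : MeasurableSet R := IsSemialgebraic.measurableSet_holds hR
  have hint : IntegrableOn f' R := by
    have h1 := r.integrableOn
    rw [← himg, integrableOn_image_iff_integrableOn_abs_det_fderiv_smul volume hRm hder hinj] at h1
    refine h1.congr_fun (fun x hx => ?_) hRm
    simp only [hf x hx, smul_eq_mul, mul_comm]
  refine ⟨⟨R, f', hR, hf'sa, hint⟩, rfl, rfl, ?_⟩
  have hcov : KZ.of (⟨R, f', hR, hf'sa, hint⟩ : KZ.IntegralRep 2) - KZ.of r ∈ KZ.relations :=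
    KZ.changeOfVariablesRel_subset_relations
      ⟨2, _, r, Ψ, Ψ', hsa, hder, hinj, himg.symm, fun x hx => hf x hx, rfl⟩
  have := KZ.relations.neg_mem hcov
  rwa [neg_sub] at this

/-! ### Fibred affine maps -/

/-- The fibred affine map `(y, t) ↦ (α y + β, l t + μ y + ν)`. -/
def affMap (α β l μ ν : ℝ) (z : Fin 2 → ℝ) : Fin 2 → ℝ := ![α * z 0 + β, l * z 1 + μ * z 0 + ν]

/-- First component of `affMap`. -/
@[simp] theorem affMap_zero (α β l μ ν : ℝ) (z : Fin 2 → ℝ) : affMap α β l μ ν z 0 = α * z 0 + β :=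
  rfl

/-- Second component of `affMap`. -/
@[simp] theorem affMap_one (α β l μ ν : ℝ) (z : Fin 2 → ℝ) :
    affMap α β l μ ν z 1 = l * z 1 + μ * z 0 + ν := rfl

/-- The linear part of `affMap`. -/
def linPart (α l μ : ℝ) : (Fin 2 → ℝ) →L[ℝ] (Fin 2 → ℝ) :=
  LinearMap.toContinuousLinearMap (Matrix.toLin' !![α, 0; μ, l])

/-- `linPart` evaluated. -/
theorem linPart_apply (α l μ : ℝ) (z : Fin 2 → ℝ) :
    linPart α l μ z = ![α * z 0, l * z 1 + μ * z 0] := by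
  ext i
  fin_cases i
  · simp [linPart, Matrix.toLin'_apply, Matrix.mulVec, dotProduct, Fin.sum_univ_two]
  · simp [linPart, Matrix.toLin'_apply, Matrix.mulVec, dotProduct, Fin.sum_univ_two]; ring

/-- The Jacobian determinant of `affMap`. -/
theorem det_linPart (α l μ : ℝ) : (linPart α l μ).det = α * l := by
  rw [ContinuousLinearMap.det, linPart, LinearMap.coe_toContinuousLinearMap, LinearMap.det_toLin',
    Matrix.det_fin_two_of]
  ring

/-- `affMap` is its linear part plus a constant. -/
theorem affMap_eq (α β l μ ν : ℝ) (z : Fin 2 → ℝ) :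
    affMap α β l μ ν z = linPart α l μ z + ![β, ν] := by
  rw [linPart_apply]
  ext i
  fin_cases i <;> simp [affMap]

/-- The derivative of `affMap`. -/
theorem hasFDerivAt_affMap (α β l μ ν : ℝ) (z : Fin 2 → ℝ) :
    HasFDerivAt (affMap α β l μ ν) (linPart α l μ) z := by
  have : affMap α β l μ ν = fun z => linPart α l μ z + ![β, ν] := funext (affMap_eq α β l μ ν)
  rw [this]
  exact (linPart α l μ).hasFDerivAt.add_const _

/-- `affMap` is injective when `α l ≠ 0`. -/
theorem affMap_injective {α l : ℝ} (hα : α ≠ 0) (hl : l ≠ 0) (β μ ν : ℝ) :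
    Function.Injective (affMap α β l μ ν) := by
  intro z w h
  have h0 := congr_fun h 0
  have h1 := congr_fun h 1
  simp only [affMap_zero, affMap_one] at h0 h1
  have hy : z 0 = w 0 := mul_left_cancel₀ hα (by linarith)
  have ht : z 1 = w 1 := mul_left_cancel₀ hl (by rw [hy] at h1; linarith)
  ext i
  fin_cases i
  · exact hy
  · exact ht

/-- `affMap` with rational data is a semialgebraic map. -/
theorem isSemialgebraicMapOn_affMap (α β l μ ν : ℚ) {s : Set (Fin 2 → ℝ)} (hs : IsSemialgebraic ℚ s) :
    IsSemialgebraicMapOn ℚ s (affMap α β l μ ν) := by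
  refine (isSemialgebraicMapOn_aeval hs ![MvPolynomial.C α * MvPolynomial.X 0 + MvPolynomial.C β,
    MvPolynomial.C l * MvPolynomial.X 1 + MvPolynomial.C μ * MvPolynomial.X 0 +
      MvPolynomial.C ν]).congr fun z _ => ?_
  ext i
  fin_cases i <;> simp [affMap]

/-- Integrability transfers through fibred affine maps (constant nonzero Jacobian). -/
theorem integrableOn_image_affMap {α l : ℝ} (hα : α ≠ 0) (hl : l ≠ 0) (β μ ν : ℝ)
    {s : Set (Fin 2 → ℝ)} (hs : MeasurableSet s) (f : (Fin 2 → ℝ) → ℝ) :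
    IntegrableOn f (affMap α β l μ ν '' s) ↔ IntegrableOn (fun z => f (affMap α β l μ ν z)) s := by
  rw [integrableOn_image_iff_integrableOn_abs_det_fderiv_smul volume hs
    (fun z _ => (hasFDerivAt_affMap α β l μ ν z).hasFDerivWithinAt) (affMap_injective hα hl β μ ν).injOn]
  simp only [det_linPart, smul_eq_mul]
  have hc : |α * l| ≠ 0 := abs_ne_zero.2 (mul_ne_zero hα hl)
  constructor
  · intro h
    refine IntegrableOn.congr_fun (h.const_mul |α * l|⁻¹) (fun z _ => ?_) hs
    rw [← mul_assoc, inv_mul_cancel₀ hc, one_mul]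
  · intro h
    exact h.const_mul |α * l|

/-- **Affine pull-back.** Rule (2) for `Ψ = affMap α β l μ ν` with rational data (`α l ≠ 0`):
given a semialgebraic `R` with `Ψ '' R = r.domain` and a semialgebraic `f'` on `R` with
`f' = (r.integrand ∘ Ψ) · |α l|`, the representation `[R, f']` exists and `[r] − [R, f']` is a
relation. -/
theorem cov_pull_aff (r : KZ.IntegralRep 2) {R : Set (Fin 2 → ℝ)} (hR : IsSemialgebraic ℚ R)
    (α β l μ ν : ℚ) (hα : α ≠ 0) (hl : l ≠ 0) (himg : affMap α β l μ ν '' R = r.domain)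
    (f' : (Fin 2 → ℝ) → ℝ) (hf'sa : IsSemialgebraicFunOn ℚ R f')
    (hf : ∀ x ∈ R, f' x = r.integrand (affMap α β l μ ν x) * |(α : ℝ) * l|) :
    ∃ r' : KZ.IntegralRep 2, r'.domain = R ∧ r'.integrand = f' ∧
      KZ.of r - KZ.of r' ∈ KZ.relations := by
  refine cov_pull r hR (affMap α β l μ ν) (fun _ => linPart α l μ) ?_
    (fun z _ => (hasFDerivAt_affMap _ _ _ _ _ z).hasFDerivWithinAt)
    ((affMap_injective (Rat.cast_ne_zero.2 hα) (Rat.cast_ne_zero.2 hl) _ _ _).injOn) himg f' hf'sa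
    fun x hx => by rw [hf x hx, det_linPart]
  have := isSemialgebraicMapOn_affMap α β l μ ν hR
  simpa using this

/-! ### Blow-up maps -/

/-- The blow-up map `(y, s) ↦ (y, γ y + δ + s (y − p))`. -/
def blowMap (γ δ p : ℝ) (z : Fin 2 → ℝ) : Fin 2 → ℝ := ![z 0, γ * z 0 + δ + z 1 * (z 0 - p)]

/-- First component of `blowMap`. -/
@[simp] theorem blowMap_zero (γ δ p : ℝ) (z : Fin 2 → ℝ) : blowMap γ δ p z 0 = z 0 := rfl

/-- Second component of `blowMap`. -/
@[simp] theorem blowMap_one (γ δ p : ℝ) (z : Fin 2 → ℝ) :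
    blowMap γ δ p z 1 = γ * z 0 + δ + z 1 * (z 0 - p) := rfl

/-- The derivative of `blowMap` at `z`. -/
def blowDeriv (γ p : ℝ) (z : Fin 2 → ℝ) : (Fin 2 → ℝ) →L[ℝ] (Fin 2 → ℝ) :=
  LinearMap.toContinuousLinearMap (Matrix.toLin' !![1, 0; γ + z 1, z 0 - p])

/-- `blowDeriv` evaluated. -/
theorem blowDeriv_apply (γ p : ℝ) (z v : Fin 2 → ℝ) :
    blowDeriv γ p z v = ![v 0, (γ + z 1) * v 0 + (z 0 - p) * v 1] := by
  ext i
  fin_cases i <;>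
    simp [blowDeriv, Matrix.toLin'_apply, Matrix.mulVec, dotProduct, Fin.sum_univ_two]

/-- The Jacobian determinant of `blowMap`. -/
theorem det_blowDeriv (γ p : ℝ) (z : Fin 2 → ℝ) : (blowDeriv γ p z).det = z 0 - p := by
  rw [ContinuousLinearMap.det, blowDeriv, LinearMap.coe_toContinuousLinearMap, LinearMap.det_toLin',
    Matrix.det_fin_two_of]
  ring

/-- The derivative of `blowMap`. -/
theorem hasFDerivAt_blowMap (γ δ p : ℝ) (z : Fin 2 → ℝ) :
    HasFDerivAt (blowMap γ δ p) (blowDeriv γ p z) z := by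
  rw [hasFDerivAt_pi']
  have h0 : HasFDerivAt (fun x : Fin 2 → ℝ => x 0)
      (ContinuousLinearMap.proj (R := ℝ) (φ := fun _ : Fin 2 => ℝ) 0) z := hasFDerivAt_apply 0 z
  have h1 : HasFDerivAt (fun x : Fin 2 → ℝ => x 1)
      (ContinuousLinearMap.proj (R := ℝ) (φ := fun _ : Fin 2 => ℝ) 1) z := hasFDerivAt_apply 1 z
  refine Fin.forall_fin_two.2 ⟨?_, ?_⟩
  · show HasFDerivAt (fun x : Fin 2 → ℝ => x 0) _ z
    refine h0.congr_fderiv ?_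
    ext v
    simp [blowDeriv_apply]
  · show HasFDerivAt (fun x : Fin 2 → ℝ => γ * x 0 + δ + x 1 * (x 0 - p)) _ z
    refine (((h0.const_mul γ).add_const δ).add (h1.mul (h0.sub_const p))).congr_fderiv ?_
    ext v
    simp [blowDeriv_apply]
    ring

/-- `blowMap` is injective off the vertical line `y = p`. -/
theorem blowMap_injOn (γ δ p : ℝ) {R : Set (Fin 2 → ℝ)} (hR : ∀ z ∈ R, z 0 ≠ p) :
    InjOn (blowMap γ δ p) R := by
  intro z hz w _ h
  have h0 := congr_fun h 0
  have h1 := congr_fun h 1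
  simp only [blowMap_zero, blowMap_one] at h0 h1
  have hy : z 0 - p ≠ 0 := sub_ne_zero.2 (hR z hz)
  rw [h0] at h1 hy
  have ht : z 1 = w 1 := mul_right_cancel₀ hy (by linarith)
  ext i
  fin_cases i
  · exact h0
  · exact ht

/-- `blowMap` with rational data is a semialgebraic map. -/
theorem isSemialgebraicMapOn_blowMap (γ δ p : ℚ) {s : Set (Fin 2 → ℝ)} (hs : IsSemialgebraic ℚ s) :
    IsSemialgebraicMapOn ℚ s (blowMap γ δ p) := by
  refine (isSemialgebraicMapOn_aeval hs ![MvPolynomial.X 0,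
    MvPolynomial.C γ * MvPolynomial.X 0 + MvPolynomial.C δ +
      MvPolynomial.X 1 * (MvPolynomial.X 0 - MvPolynomial.C p)]).congr fun z _ => ?_
  ext i
  fin_cases i <;> simp [blowMap]

/-- **Blow-up pull-back.** Rule (2) for `Ψ = blowMap γ δ p` with rational data on a semialgebraic
`R` missing the line `y = p`: given `Ψ '' R = r.domain` and a semialgebraic `f'` on `R` with
`f' = (r.integrand ∘ Ψ) · |y − p|`, the representation `[R, f']` exists and `[r] − [R, f']` is a
relation. -/
theorem cov_pull_blow (r : KZ.IntegralRep 2) {R : Set (Fin 2 → ℝ)} (hR : IsSemialgebraic ℚ R)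
    (γ δ p : ℚ) (hRp : ∀ z ∈ R, z 0 ≠ p) (himg : blowMap γ δ p '' R = r.domain)
    (f' : (Fin 2 → ℝ) → ℝ) (hf'sa : IsSemialgebraicFunOn ℚ R f')
    (hf : ∀ x ∈ R, f' x = r.integrand (blowMap γ δ p x) * |x 0 - p|) :
    ∃ r' : KZ.IntegralRep 2, r'.domain = R ∧ r'.integrand = f' ∧
      KZ.of r - KZ.of r' ∈ KZ.relations :=
  cov_pull r hR (blowMap γ δ p) (blowDeriv γ p) (isSemialgebraicMapOn_blowMap γ δ p hR)
    (fun z _ => (hasFDerivAt_blowMap _ _ _ z).hasFDerivWithinAt) (blowMap_injOn _ _ _ hRp) himg f'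
    hf'sa fun x hx => by rw [hf x hx, det_blowDeriv]

end RebaseOne

/-- Registered support goal of this file: the pull-back form of rule (2) in the plane. -/
theorem rebaseOne_cov_pull (r : KZ.IntegralRep 2) (R : Set (Fin 2 → ℝ)) (hR : Literature.ModelTheory.ExponentialFields.IsSemialgebraic ℚ R) (Ψ : (Fin 2 → ℝ) → (Fin 2 → ℝ)) (Ψ' : (Fin 2 → ℝ) → (Fin 2 → ℝ) →L[ℝ] (Fin 2 → ℝ)) (hsa : IsSemialgebraicMapOn ℚ R Ψ) (hder : ∀ x ∈ R, HasFDerivWithinAt Ψ (Ψ' x) R x) (hinj : InjOn Ψ R) (himg : Ψ '' R = r.domain) (f' : (Fin 2 → ℝ) → ℝ) (hf'sa : IsSemialgebraicFunOn ℚ R f') (hf : ∀ x ∈ R, f' x = r.integrand (Ψ x) * |(Ψ' x).det|) : ∃ r' : KZ.IntegralRep 2, r'.domain = R ∧ r'.integrand = f' ∧ KZ.of r - KZ.of r' ∈ KZ.relations :=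
  RebaseOne.cov_pull r hR Ψ Ψ' hsa hder hinj himg f' hf'sa hf

end Summit.KontsevichZagierPeriods.ArrangementNormalForm.JanusBands
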